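/-
Copyright (c) 2026. All rights reserved.
Released under Apache 2.0 license as described in the file LICENSE.
Authors: abc-iut cell, seat abc-iut-w6-d025 (block C / W6 cone prover; node `AbsTopIII:Cor4.5(v)`).
-/
import Literature.AnabelianGeometry.AbsoluteAnabelian.ArchimedeanLogFrobeniusModelTMGalois
import HarnessLib

/-!
# [AbsTopIII] Cor 4.5 (v): the id-rigidity input is EXACTLY necessary (abstract), and item (v) at the
# archimedean models is EQUIVALENT to the id-rigidity of `EA` (Prop 4.2 (i))

S. Mochizuki, *Topics in Absolute Anabelian Geometry III*, Cor 4.5 (v) p. 109 (proof p. 110 l. 40–42: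
"the total `□`-rigidity portion of assertion (v) follows immediately from Proposition 4.2, (i) [cf. also
the final portion of Proposition 4.2, (ii)]; the remainder of assertion (v) follows immediately from the
definitions"), Prop 4.2 (i) p. 105 ("the categories `EA`, `𝒞^hol_T`, … are id-rigid"), Def 3.5 (v)/(vi)
pp. 76–77 (total rigidity, total `□`-rigidity) of the author's kurims manuscript (lit key
`paper:url-5493eb38cbb7`; bib key `MochizukiAbsTopIII2015`).  PROOF-ONLY companion (abc-iut cell, node
`AbsTopIII:Cor4.5(v)`, sub-DAG rows C45-L06/L07 of plan/L4/SUBDAG-AbsTopIII-Cor45.md; seat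
abc-iut-w6-d025) of abc-iut-L4-t10's statement file `AbsTopIII/AutHolLogFrobenius.lean`
(`Cor_4_5_v Δ := Δ.NexusRigidStmt ∧ Δ.ShiftStmt`, imported, never restated).  No new notion is declared.

What the tree had: the REDUCTIONS `LogFrobeniusData.nexusRigidStmt_of` (abc-iut-L4-t12),
`AbsTopIII.cor_4_5_v_of_isIdRigid` / `cor_4_5_v_of_isEquivalence` (abc-iut-w5-d210) — (v) FROM the
id-rigidity of the vertex categories and the rigidity of `id_⋎` — and, at the archimedean models, (v)
bundled inside `cor_4_5_arch 𝔄 X₀ hE` / `cor_4_5_arch_TM 𝔄 X₀ hE` (abc-iut-L4-t10, abc-iut-w5-d226) with an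
object binder `X₀` that item (v) does not use.  This file adds the CONVERSES:

* `LogFrobeniusData.nexusRigidStmt_iff_isIdRigid` — for EVERY input datum `Δ`, "`□` is a nexus and `𝒟` is
  totally `□`-rigid" holds IFF `X₁` and `𝒳` are id-rigid and `id_⋎` is rigid (Def 3.5 (v)/(vi) unfolded on
  the pre-nexus portion `𝒟_{≤□}`: the first-row vertices carry `X₁`, `□` carries `𝒳`, the edges carry
  `𝔩𝔬𝔤 ≅ 𝟭` and `id_⋎`); in print's configuration (`id_⋎` an equivalence) IFF `𝒳` is id-rigid
  (`nexusRigidStmt_iff_of_isEquivalence`).  Hence `AbsTopIII.cor_4_5_v_iff`,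
  `AbsTopIII.cor_4_5_v_iff_isIdRigid`: the printed input "`𝒞^hol_T` is id-rigid" (Prop 4.2 (i)) of
  Cor 4.5 (v) is EXACTLY NECESSARY — the conditional form recorded for the node (FACT-LIST F-0310,
  `conditional(G: cor_4_5_v_of_isEquivalence)`) is sharp, and no unconditional `∀ Δ` form can exist.
* `AbsTopIII.cor_4_5_v_arch_iff` / `cor_4_5_v_arch_TM_iff` — at BOTH archimedean models
  (`T = TF`: `archLogFrobeniusData 𝔄`; `T = TM`: `archLogFrobeniusDataTM 𝔄`) over the Cor 2.7 (e)
  interface `𝔄 : AutHolFieldFunctor`, item (v) holds IFF `EA` is id-rigid — the first clause of Prop 4.2 (i)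
  ("Thus, the id-rigidity of `EA` follows immediately from the slimness assertion of Lemma 4.3", proof
  p. 106), i.e. the node `AbsTopIII:Prop4.2(i)` BY NAME, with NO object binder; the two models agree
  (`cor_4_5_v_arch_iff_TM`).
* zero-`X₀` corollaries: `cor_4_5_v_arch` / `cor_4_5_v_arch_TM` (from `IsIdRigid EA`),
  `cor_4_5_v_arch_of_isSlim` (from slimness of `EA`), `cor_4_5_v_arch_ofGaloisCategory` /
  `cor_4_5_v_arch_TM_ofGaloisCategory` (Galois-category instance `EA = B(Π)`, from `IsSlimGroup Π`
  ALONE), and the negative form `not_cor_4_5_v_arch_of_not_isIdRigid` /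
  `not_cor_4_5_v_arch_ofConstField` (item (v) FAILS at the model over any non-id-rigid `EA`).
* rider (appended): id-rigidity DESCENDS along `ULiftHom` (`isIdRigid_of_isIdRigid_uLiftHom`,
  `isIdRigid_uLiftHom_iff`; converse of abc-iut-L4-t10's `isIdRigid_uLiftHom`), so at the Galois-category
  instance item (v) holds IFF `B(Π)` is id-rigid (`cor_4_5_v_arch_ofGaloisCategory_iff`, + `TM`).

Honest scope: sentences 1–2 of (v) as typed (`Cor_4_5_v`); sentences 3–4 (compatibility of the shifts
with the families of homotopies, `Cor_4_5_v_compat` of `AutHolLogFrobeniusCompatibility.lean`) are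
abc-iut-L4-t5's Cor 3.6 (v) statements verbatim over the same abstract data and are NOT addressed here.
The id-rigidity of the GEOMETRIC `EA` (elliptically admissible hyperbolic orbicurves; Lemma 4.3 + Cor 2.3
(i)) is not proved here (GAP-LEDGER G-w5d226-1 dispositions; geometric-model instances by abc-iut-L4-t14
/ -t10).  Refereed pre-IUT anabelian geometry; nothing here bears on [IUTchIII] Cor. 3.12 or takes a
side; typed ≠ proved; model-level ≠ node-level.
-/

namespace Literature.AnabelianGeometry.AbsoluteAnabelian

open _root_.CategoryTheory _root_.Quiver

universe u

/-! ### Abstract input data: total `□`-rigidity unfolded (Def 3.5 (v)/(vi)) -/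

namespace LogFrobeniusData

open DiagramOfCategories

variable (Δ : LogFrobeniusData.{u})

/-- Total `□`-rigidity of `𝒟` forces the id-rigidity of the first-row category `X₁` (vertex-rigidity
of `𝒟_{≤□}` at the vertex `⋎ = 0`). [cite: MochizukiAbsTopIII2015, Definition 3.5 (vi) p.77] -/
theorem isIdRigid_X₁_of_nexusRigidStmt (h : Δ.NexusRigidStmt) : IsIdRigid Δ.X₁ :=
  (Δ.nexusRigidStmt_iff.1 h).1 ⟨.row1 0, Or.inl rfl⟩

/-- Total `□`-rigidity of `𝒟` forces the id-rigidity of the nexus category `𝒳` (vertex-rigidity of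
`𝒟_{≤□}` at `□`). [cite: MochizukiAbsTopIII2015, Definition 3.5 (vi) p.77] -/
theorem isIdRigid_X_of_nexusRigidStmt (h : Δ.NexusRigidStmt) : IsIdRigid Δ.X :=
  (Δ.nexusRigidStmt_iff.1 h).1 ⟨.nexus, Or.inr rfl⟩

/-- Total `□`-rigidity of `𝒟` forces the rigidity of `id_⋎ : X₁ ⥤ 𝒳` (edge-rigidity of `𝒟_{≤□}` at the
edge `⋎ → □`). [cite: MochizukiAbsTopIII2015, Definition 3.5 (vi) p.77] -/
theorem isRigidFunctor_toNexus_of_nexusRigidStmt (h : Δ.NexusRigidStmt) :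
    IsRigidFunctor Δ.toNexus := by
  obtain ⟨_, hE⟩ := Δ.nexusRigidStmt_iff.1 h
  exact @hE ⟨.row1 0, Or.inl rfl⟩ ⟨.nexus, Or.inr rfl⟩ (LFVertex.idEdge 0)

/-- Total `□`-rigidity of `𝒟` forces the rigidity of `𝔩𝔬𝔤 : X₁ ⥤ X₁` (edge-rigidity of `𝒟_{≤□}` at the
first-row edge `1 → 0`). [cite: MochizukiAbsTopIII2015, Definition 3.5 (vi) p.77] -/
theorem isRigidFunctor_log_of_nexusRigidStmt (h : Δ.NexusRigidStmt) : IsRigidFunctor Δ.log := by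
  obtain ⟨_, hE⟩ := Δ.nexusRigidStmt_iff.1 h
  exact @hE ⟨.row1 (0 + 1), Or.inl rfl⟩ ⟨.row1 0, Or.inl rfl⟩ (LFVertex.logEdge 0)

/-- **Cor. 3.6 (v) / 4.5 (v), first two sentences, UNFOLDED**: for every input datum, "`□` is a nexus of
`Γ⃗_𝒟` and `𝒟` is totally `□`-rigid" holds IFF the first-row category `X₁` and the nexus category `𝒳` are
id-rigid and `id_⋎` is rigid (the rigidity of `𝔩𝔬𝔤` being automatic from `𝔩𝔬𝔤 ≅ 𝟭`, "the final portion
of Proposition 4.2, (ii)").  The forward direction is Def. 3.5 (v)/(vi) read at the vertices `⋎ = 0`,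
`□` and the edge `id_0`; the backward direction is abc-iut-L4-t12's `nexusRigidStmt_of`.
[cite: MochizukiAbsTopIII2015, Corollary 4.5 (v) p.109] -/
theorem nexusRigidStmt_iff_isIdRigid :
    Δ.NexusRigidStmt ↔ IsIdRigid Δ.X₁ ∧ IsIdRigid Δ.X ∧ IsRigidFunctor Δ.toNexus :=
  ⟨fun h => ⟨Δ.isIdRigid_X₁_of_nexusRigidStmt h, Δ.isIdRigid_X_of_nexusRigidStmt h,
      Δ.isRigidFunctor_toNexus_of_nexusRigidStmt h⟩,
    fun h => Δ.nexusRigidStmt_of h.1 h.2.1 h.2.2⟩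

/-- **Print's configuration** (`X₁ = 𝒳`, `id_⋎` an equivalence — in Cor. 3.6 / 4.5 proper the identity
functor): total `□`-rigidity of `𝒟` holds IFF `𝒳` is id-rigid — the single model-dependent input,
Prop. 3.2 (iv) (MLF case) / Prop. 4.2 (i) (archimedean case), is EXACTLY necessary.
[cite: MochizukiAbsTopIII2015, Corollary 4.5 (v) p.109] -/
theorem nexusRigidStmt_iff_of_isEquivalence [Δ.toNexus.IsEquivalence] :
    Δ.NexusRigidStmt ↔ IsIdRigid Δ.X :=
  ⟨Δ.isIdRigid_X_of_nexusRigidStmt, Δ.nexusRigidStmt_of_isEquivalence⟩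

end LogFrobeniusData

/-! ### Cor 4.5 (v) over abstract input data: the iff forms -/

namespace AbsTopIII

variable (Δ : LogFrobeniusData.{u})

/-- `Cor_4_5_v Δ` is equivalent to its rigidity half: the `ℤ`-action by nexus-classes of
self-equivalences (`ShiftStmt`) exists for every input datum (abc-iut-L4-t5's `shiftStmt`).
[cite: MochizukiAbsTopIII2015, Corollary 4.5 (v) p.109] -/
theorem cor_4_5_v_iff_nexusRigidStmt :
    Literature.AnabelianGeometry.AbsoluteAnabelian.AbsTopIII.Cor_4_5_v Δ ↔ Δ.NexusRigidStmt :=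
  ⟨fun h => h.1, fun h => ⟨h, Δ.shiftStmt⟩⟩

/-- **Cor. 4.5 (v), first two sentences, for an arbitrary input datum: EXACTLY the id-rigidity inputs.**
`Cor_4_5_v Δ` ("`□` is a nexus, `𝒟` is totally `□`-rigid, and `ℤ` acts by nexus-classes of
self-equivalences") holds IFF `X₁`, `𝒳` are id-rigid and `id_⋎` is rigid — the hypotheses of
abc-iut-w5-d210's `cor_4_5_v_of_isIdRigid` are necessary as well as sufficient.
[cite: MochizukiAbsTopIII2015, Corollary 4.5 (v) p.109] -/
theorem cor_4_5_v_iff :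
    Literature.AnabelianGeometry.AbsoluteAnabelian.AbsTopIII.Cor_4_5_v Δ ↔
      IsIdRigid Δ.X₁ ∧ IsIdRigid Δ.X ∧ IsRigidFunctor Δ.toNexus :=
  (cor_4_5_v_iff_nexusRigidStmt Δ).trans Δ.nexusRigidStmt_iff_isIdRigid

/-- **Cor. 4.5 (v) in print's configuration IFF Prop. 4.2 (i)'s clause for `𝒳`**: when `id_⋎` is an
equivalence (in Cor. 4.5 proper, the identity functor of `𝒳 = 𝒞^hol_T`), `Cor_4_5_v Δ` holds IFF `𝒳` is
id-rigid.  The printed input "follows immediately from Proposition 4.2, (i)" is thus the EXACT content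
of the rigidity half of (v). [cite: MochizukiAbsTopIII2015, Corollary 4.5 (v) p.109] -/
theorem cor_4_5_v_iff_isIdRigid [Δ.toNexus.IsEquivalence] :
    Literature.AnabelianGeometry.AbsoluteAnabelian.AbsTopIII.Cor_4_5_v Δ ↔ IsIdRigid Δ.X :=
  (cor_4_5_v_iff_nexusRigidStmt Δ).trans Δ.nexusRigidStmt_iff_of_isEquivalence

variable {Δ} in
/-- Necessity alone: wherever Cor. 4.5 (v) holds as typed, the nexus category `𝒳` is id-rigid.
[cite: MochizukiAbsTopIII2015, Corollary 4.5 (v) p.109] -/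
theorem isIdRigid_of_cor_4_5_v
    (h : Literature.AnabelianGeometry.AbsoluteAnabelian.AbsTopIII.Cor_4_5_v Δ) : IsIdRigid Δ.X :=
  Δ.isIdRigid_X_of_nexusRigidStmt h.1

variable {Δ} in
/-- Negative form: over a nexus category that is NOT id-rigid, Cor. 4.5 (v) fails as typed — so
`Cor_4_5_v` is not a property of every `LogFrobeniusData`. [cite: MochizukiAbsTopIII2015, Corollary 4.5 (v) p.109] -/
theorem not_cor_4_5_v_of_not_isIdRigid (h : ¬ IsIdRigid Δ.X) :
    ¬ Literature.AnabelianGeometry.AbsoluteAnabelian.AbsTopIII.Cor_4_5_v Δ :=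
  fun hv => h (isIdRigid_of_cor_4_5_v hv)

end AbsTopIII

/-! ### The archimedean models: `𝒞^hol_T` is id-rigid IFF `EA` is (Prop 4.2 (i), both directions) -/

namespace HolTFPair

variable (𝔄 : AutHolFieldFunctor.{u})

/-- Converse of abc-iut-L4-t10's `isIdRigid_of_isIdRigid_EA`: if `𝒞^hol_TF` is id-rigid then so is `EA`
(`𝕏 ↦ (𝕏 ↶ 𝒜_𝕏)` is an equivalence `EA ≌ 𝒞^hol_TF`, "in light of the bijectivity portion of assertion
(i)"). [cite: MochizukiAbsTopIII2015, Proposition 4.2 (i) p.105] -/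
theorem isIdRigid_EA_of_isIdRigid (h : IsIdRigid (HolTFPair 𝔄)) : IsIdRigid 𝔄.EA :=
  haveI := ofEA_isEquivalence 𝔄
  isIdRigid_of_equivalence (ofEA 𝔄).asEquivalence h

/-- **Prop. 4.2 (i), id-rigidity clause, at the `TF` model, as an IFF**: `𝒞^hol_TF` is id-rigid iff
`EA` is. [cite: MochizukiAbsTopIII2015, Proposition 4.2 (i) p.105] -/
theorem isIdRigid_iff_isIdRigid_EA : IsIdRigid (HolTFPair 𝔄) ↔ IsIdRigid 𝔄.EA :=
  ⟨isIdRigid_EA_of_isIdRigid 𝔄, isIdRigid_of_isIdRigid_EA 𝔄⟩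

end HolTFPair

namespace HolMonoidPair

variable (𝔄 : AutHolFieldFunctor.{u}) {T : ArchPairType}

/-- Converse of abc-iut-w5-d226's `isIdRigid_of_isIdRigid_EA` (`T ∈ {TM, TLG, TCG}`): if `𝒞^hol_T` is
id-rigid then so is `EA` (equivalence `EA ≌ 𝒞^hol_T`).
[cite: MochizukiAbsTopIII2015, Proposition 4.2 (i) p.105] -/
theorem isIdRigid_EA_of_isIdRigid (hT : T.IsMonoidType) (h : IsIdRigid (HolMonoidPair 𝔄 T)) :
    IsIdRigid 𝔄.EA :=
  haveI := ofEA_isEquivalence (𝔄 := 𝔄) hT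
  isIdRigid_of_equivalence (ofEA 𝔄 hT).asEquivalence h

/-- **Prop. 4.2 (i), id-rigidity clause, at the monoid-type models, as an IFF**: `𝒞^hol_T` is id-rigid
iff `EA` is (`T ∈ {TM, TLG, TCG}`). [cite: MochizukiAbsTopIII2015, Proposition 4.2 (i) p.105] -/
theorem isIdRigid_iff_isIdRigid_EA (hT : T.IsMonoidType) :
    IsIdRigid (HolMonoidPair 𝔄 T) ↔ IsIdRigid 𝔄.EA :=
  ⟨isIdRigid_EA_of_isIdRigid 𝔄 hT, isIdRigid_of_isIdRigid_EA hT⟩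

end HolMonoidPair

/-! ### Cor 4.5 (v) at the archimedean models: IFF `EA` is id-rigid; zero-object-binder corollaries -/

namespace AbsTopIII

variable (𝔄 : AutHolFieldFunctor.{u})

/-- **[AbsTopIII] Cor. 4.5 (v) at the archimedean model `T = TF` IFF `EA` is id-rigid.**  For the model
`archLogFrobeniusData 𝔄` (`𝒳 = X₁ = 𝒞^hol_TF`, `id_⋎ = 𝟭`), item (v) as typed holds IFF the category `EA`
of the interface is id-rigid — the first clause of Prop. 4.2 (i) ("the id-rigidity of `EA` follows
immediately from the slimness assertion of Lemma 4.3"), i.e. node `AbsTopIII:Prop4.2(i)`, and NOTHING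
else: no object of `EA` is needed (contrast `cor_4_5_arch 𝔄 X₀ hE`).
[cite: MochizukiAbsTopIII2015, Corollary 4.5 (v) p.109] -/
theorem cor_4_5_v_arch_iff :
    Literature.AnabelianGeometry.AbsoluteAnabelian.AbsTopIII.Cor_4_5_v (archLogFrobeniusData 𝔄) ↔
      IsIdRigid 𝔄.EA := by
  haveI : (archLogFrobeniusData 𝔄).toNexus.IsEquivalence := Functor.isEquivalence_refl
  exact (cor_4_5_v_iff_isIdRigid (archLogFrobeniusData 𝔄)).trans
    (HolTFPair.isIdRigid_iff_isIdRigid_EA 𝔄)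

/-- **Cor. 4.5 (v) at the `TF` model from the id-rigidity of `EA` alone** (no object binder).
[cite: MochizukiAbsTopIII2015, Corollary 4.5 (v) p.109] -/
theorem cor_4_5_v_arch (hE : IsIdRigid 𝔄.EA) :
    Literature.AnabelianGeometry.AbsoluteAnabelian.AbsTopIII.Cor_4_5_v (archLogFrobeniusData 𝔄) :=
  (cor_4_5_v_arch_iff 𝔄).2 hE

/-- Necessity at the `TF` model: if Cor. 4.5 (v) holds for `archLogFrobeniusData 𝔄` then `EA` is
id-rigid. [cite: MochizukiAbsTopIII2015, Corollary 4.5 (v) p.109] -/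
theorem isIdRigid_EA_of_cor_4_5_v_arch
    (h : Literature.AnabelianGeometry.AbsoluteAnabelian.AbsTopIII.Cor_4_5_v (archLogFrobeniusData 𝔄)) :
    IsIdRigid 𝔄.EA :=
  (cor_4_5_v_arch_iff 𝔄).1 h

/-- **[AbsTopIII] Cor. 4.5 (v) at the archimedean model `T = TM` IFF `EA` is id-rigid** (the model
`archLogFrobeniusDataTM 𝔄` of abc-iut-w5-d226: `𝒳 = X₁ = 𝒞^hol_TM`, `id_⋎ = 𝟭`).
[cite: MochizukiAbsTopIII2015, Corollary 4.5 (v) p.109] -/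
theorem cor_4_5_v_arch_TM_iff :
    Literature.AnabelianGeometry.AbsoluteAnabelian.AbsTopIII.Cor_4_5_v (archLogFrobeniusDataTM 𝔄) ↔
      IsIdRigid 𝔄.EA := by
  haveI : (archLogFrobeniusDataTM 𝔄).toNexus.IsEquivalence := Functor.isEquivalence_refl
  exact (cor_4_5_v_iff_isIdRigid (archLogFrobeniusDataTM 𝔄)).trans
    (HolMonoidPair.isIdRigid_iff_isIdRigid_EA 𝔄 ArchPairType.isMonoidType_TM)

/-- **Cor. 4.5 (v) at the `TM` model from the id-rigidity of `EA` alone** (no object binder).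
[cite: MochizukiAbsTopIII2015, Corollary 4.5 (v) p.109] -/
theorem cor_4_5_v_arch_TM (hE : IsIdRigid 𝔄.EA) :
    Literature.AnabelianGeometry.AbsoluteAnabelian.AbsTopIII.Cor_4_5_v (archLogFrobeniusDataTM 𝔄) :=
  (cor_4_5_v_arch_TM_iff 𝔄).2 hE

/-- "`T ∈ {TM, TF}`": item (v) holds at the `TF` model iff it holds at the `TM` model (both iff `EA` is
id-rigid). [cite: MochizukiAbsTopIII2015, Corollary 4.5 (v) p.109] -/
theorem cor_4_5_v_arch_iff_TM :
    Literature.AnabelianGeometry.AbsoluteAnabelian.AbsTopIII.Cor_4_5_v (archLogFrobeniusData 𝔄) ↔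
      Literature.AnabelianGeometry.AbsoluteAnabelian.AbsTopIII.Cor_4_5_v (archLogFrobeniusDataTM 𝔄) :=
  (cor_4_5_v_arch_iff 𝔄).trans (cor_4_5_v_arch_TM_iff 𝔄).symm

/-- **Cor. 4.5 (v) at the `TF` model from the slimness of `EA`** — the printed route "the id-rigidity of
`EA` follows immediately from the slimness assertion of Lemma 4.3" (proof of Prop. 4.2 (i), p. 106), via
abc-iut-w5-d215's `isIdRigid_of_isSlim`. [cite: MochizukiAbsTopIII2015, Proposition 4.2 (i) p.106] -/
theorem cor_4_5_v_arch_of_isSlim (hE : Literature.AlgebraicGeometry.Frobenioids.IsSlim 𝔄.EA) :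
    Literature.AnabelianGeometry.AbsoluteAnabelian.AbsTopIII.Cor_4_5_v (archLogFrobeniusData 𝔄) :=
  cor_4_5_v_arch 𝔄 (isIdRigid_of_isSlim hE)

/-- Negative form at the `TF` model: over an interface datum whose `EA` is NOT id-rigid, Cor. 4.5 (v)
FAILS for the archimedean model. [cite: MochizukiAbsTopIII2015, Corollary 4.5 (v) p.109] -/
theorem not_cor_4_5_v_arch_of_not_isIdRigid (h : ¬ IsIdRigid 𝔄.EA) :
    ¬ Literature.AnabelianGeometry.AbsoluteAnabelian.AbsTopIII.Cor_4_5_v (archLogFrobeniusData 𝔄) :=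
  fun hv => h ((cor_4_5_v_arch_iff 𝔄).1 hv)

/-- Negative form at the constant-field instance: for ANY category `E` that is not id-rigid, Cor. 4.5 (v)
fails for the archimedean model over abc-iut-L4-t10's `AutHolFieldFunctor.ofConstField E` (`EA := E`,
`𝒜 := ℂ`, `𝒜_φ := id`) — an archimedean-direction (`ι_× = inr`) failure of the typed (v).
[cite: MochizukiAbsTopIII2015, Corollary 4.5 (v) p.109] -/
theorem not_cor_4_5_v_arch_ofConstField {E : Type 1} [Category.{1} E] (h : ¬ IsIdRigid E) :
    ¬ Literature.AnabelianGeometry.AbsoluteAnabelian.AbsTopIII.Cor_4_5_v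
        (archLogFrobeniusData (AutHolFieldFunctor.ofConstField E)) :=
  not_cor_4_5_v_arch_of_not_isIdRigid (AutHolFieldFunctor.ofConstField E) h

section Galois

variable {G : Type} [Group G] [TopologicalSpace G]

open Literature.AlgebraicGeometry.Frobenioids (IsSlimGroup)

/-- **Cor. 4.5 (v) at the Galois-category instance `EA = B(Π)`, `T = TF`, from the slimness of `Π`
ALONE** (Lemma 4.3: "the étale fundamental group `Π_X` of `X` is slim"; abc-iut-L4-t10's
`isIdRigid_EA_ofGaloisCategory`) — no finite étale covering needs to be named (contrast
`cor_4_5_arch_ofGaloisCategory hG X₀`). [cite: MochizukiAbsTopIII2015, Corollary 4.5 (v) p.109] -/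
theorem cor_4_5_v_arch_ofGaloisCategory [IsTopologicalGroup G] [CompactSpace G] [T2Space G]
    [TotallyDisconnectedSpace G] (hG : IsSlimGroup G) :
    Literature.AnabelianGeometry.AbsoluteAnabelian.AbsTopIII.Cor_4_5_v
      (archLogFrobeniusData (AutHolFieldFunctor.ofGaloisCategory G)) :=
  cor_4_5_v_arch _ (AutHolFieldFunctor.isIdRigid_EA_ofGaloisCategory hG)

/-- The same at the `TM` model. [cite: MochizukiAbsTopIII2015, Corollary 4.5 (v) p.109] -/
theorem cor_4_5_v_arch_TM_ofGaloisCategory [IsTopologicalGroup G] [CompactSpace G] [T2Space G]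
    [TotallyDisconnectedSpace G] (hG : IsSlimGroup G) :
    Literature.AnabelianGeometry.AbsoluteAnabelian.AbsTopIII.Cor_4_5_v
      (archLogFrobeniusDataTM (AutHolFieldFunctor.ofGaloisCategory G)) :=
  cor_4_5_v_arch_TM _ (AutHolFieldFunctor.isIdRigid_EA_ofGaloisCategory hG)

end Galois

end AbsTopIII

/-! ### Rider: id-rigidity descends along `ULiftHom`; the Galois-category instance as an IFF -/

section ULiftHomDescent

universe w' v' u'

variable {C : Type u'} [Category.{v'} C]

/-- **Id-rigidity descends along `ULiftHom`** (converse of abc-iut-L4-t10's `isIdRigid_uLiftHom`): an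
automorphism `α` of `𝟭_C` lifts, by `ULift.up` on components, to an automorphism of `𝟭_{ULiftHom C}`
(built inside the proof), which is trivial; hence so is `α`.  Lifting the universe of the hom-types
changes nothing about automorphisms of the identity functor. [cite: MochizukiAbsTopIII2015, Section 0 p.27] -/
theorem isIdRigid_of_isIdRigid_uLiftHom (hC : IsIdRigid (ULiftHom.{w'} C)) : IsIdRigid C := by
  refine isRigidFunctor_of_hom_app_eq_id fun α x => ?_
  let β : 𝟭 (ULiftHom.{w'} C) ≅ 𝟭 (ULiftHom.{w'} C) :=
    NatIso.ofComponents
      (fun y =>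
        { hom := ULift.up (α.hom.app y.objDown)
          inv := ULift.up (α.inv.app y.objDown)
          hom_inv_id := congrArg ULift.up (α.hom_inv_id_app y.objDown)
          inv_hom_id := congrArg ULift.up (α.inv_hom_id_app y.objDown) })
      (fun {y y'} f => congrArg ULift.up (α.hom.naturality f.down))
  have hβ : β.hom.app (ULiftHom.objUp x) = 𝟙 (ULiftHom.objUp x) := hC.hom_app_eq_id β (ULiftHom.objUp x)
  exact congrArg ULift.down hβ

/-- `ULiftHom C` is id-rigid iff `C` is. [cite: MochizukiAbsTopIII2015, Section 0 p.27] -/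
theorem isIdRigid_uLiftHom_iff : IsIdRigid (ULiftHom.{w'} C) ↔ IsIdRigid C :=
  ⟨isIdRigid_of_isIdRigid_uLiftHom, isIdRigid_uLiftHom⟩

end ULiftHomDescent

namespace AbsTopIII

section GaloisIff

variable {G : Type} [Group G] [TopologicalSpace G]

/-- **Cor. 4.5 (v) at the Galois-category instance (`T = TF`) IFF `B(Π)` is id-rigid**: over
`EA = B(Π)` (hom-types lifted), item (v) for the archimedean model holds iff the Galois category of finite
continuous `Π`-sets is id-rigid — e.g. when `Π` is slim (`cor_4_5_v_arch_ofGaloisCategory`), and NOT when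
the identity functor of `B(Π)` has a nontrivial automorphism (e.g. from a nontrivial central element of `Π`).
[cite: MochizukiAbsTopIII2015, Corollary 4.5 (v) p.109] -/
theorem cor_4_5_v_arch_ofGaloisCategory_iff :
    Literature.AnabelianGeometry.AbsoluteAnabelian.AbsTopIII.Cor_4_5_v
        (archLogFrobeniusData (AutHolFieldFunctor.ofGaloisCategory G)) ↔
      IsIdRigid (Literature.AlgebraicGeometry.Frobenioids.BCat G) :=
  (cor_4_5_v_arch_iff _).trans
    (show IsIdRigid (ULiftHom.{1} (Literature.AlgebraicGeometry.Frobenioids.BCat G)) ↔ _ from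
      isIdRigid_uLiftHom_iff)

/-- The same at the `TM` model. [cite: MochizukiAbsTopIII2015, Corollary 4.5 (v) p.109] -/
theorem cor_4_5_v_arch_TM_ofGaloisCategory_iff :
    Literature.AnabelianGeometry.AbsoluteAnabelian.AbsTopIII.Cor_4_5_v
        (archLogFrobeniusDataTM (AutHolFieldFunctor.ofGaloisCategory G)) ↔
      IsIdRigid (Literature.AlgebraicGeometry.Frobenioids.BCat G) :=
  (cor_4_5_v_arch_iff_TM _).symm.trans cor_4_5_v_arch_ofGaloisCategory_iff

end GaloisIff

end AbsTopIII

end Literature.AnabelianGeometry.AbsoluteAnabelian
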